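import Summits.AtomisticToContinuum.Crystallization.Theorems.TransitiveLocalLimit.Negative.LoadBearing
import Summits.AtomisticToContinuum.Crystallization.Theorems.TransitiveLocalLimit.Negative.UniformFloor
import Summits.AtomisticToContinuum.Crystallization.Theorems.TransitiveLocalLimit.Negative.FiniteExcluded
import Summits.AtomisticToContinuum.Crystallization.Theorems.TransitiveLocalLimit.Negative.StubSuperBoundSparse
import Summits.AtomisticToContinuum.Crystallization.Theorems.PerronTransitivityFractionalGainGivesTransitivity

/-!
# Disproof of `TransitiveLocalLimit` (stmt-AtomisticToContinuum-15100) — findings of the standing disprover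
# (cdisprove, cycle 1, 2026-08-17).  VERDICT SO FAR: NO KILL.  Four negative files landed (all ACCEPTED).

Crux (route `PerronTransitivity`, rank 4; `Theses/PerronTransitivity.lean`):
`∀ x, (∀ N, IsGroundState V_LJ (x N)) → ∃ X σ τ, X.Nonempty ∧ (X uniformly discrete) ∧ StrictMono σ ∧`
`(two-way ε-matching of x (σ j) + τ j with X on every ball ‖·‖ ≤ R, eventually in j) ∧ ∀ p ∈ X, U_X(p) = 2E*`,
`U_X(p) = ∑'_{q ∈ X, q ≠ p} V_LJ(dist p q)`, `E* = ⨅_Q e_LJ(Q)` (`= ChargedEnergyGapNegative.eStar`, `rfl`).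
READ-BACK (W.lean, rc 0): no junk route — the `tsum` is a genuine sum for uniformly discrete `X`
(`summable_site`), `⨅` is a genuine infimum (`bddBelow_energyPerParticle_lennardJones`, item 0714 PROVED),
`−14.316/12 ≤ E* ≤ −0.711` (this file / `OnePercentFccRung`), `R < 0` is vacuous but harmless, and a finite `X`
cannot satisfy the conclusion at `#X = 1` (`singleton_not_transitive`).  The hypothesis is satisfiable
(`LennardJonesGroundStatesExist_holds`) and only `IsGroundState = Injective ∧ (𝓔 = E(N))` is assumed.

INDEX (letters as in the cdisprove protocol; everything is sorry-free and (a), (b), (d) are LANDED under Negative/):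

(a) LOAD-BEARING HYPOTHESES — `Theorems/TransitiveLocalLimit/Negative/LoadBearing.lean` (p150251, ACCEPTED):
    * `transitiveLocalLimit_false_without_minimality` : ¬ (crux with `IsGroundState` weakened to injectivity).
      Witness: spread-out collinear `x N i = (N·i)·e₀` — every admissible local limit is a SINGLETON (two points
      of `X` would be matched at a late stage by two particles `≥ σ j → ∞` apart), whose site sum is `0 ≠ 2E*`.
      So every proof must use minimality; matching + separation + non-emptiness carry no energetic content.
    * `singleton_not_transitive` : the degenerate limit `X = {p}` is excluded (`tsum_empty`, `2E* ≤ −1`).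
    (Injectivity alone is not worth dropping: `E(N)` is an infimum over injective configurations.)
(b) TIGHTNESS — `Theorems/TransitiveLocalLimit/Negative/UniformFloor.lean` (p150307, ACCEPTED):
    * `not_uniformly_superBound` : **`2E*` is the UNIFORM BINDING FLOOR of EVERY non-empty uniformly discrete
      `X ⊆ ℝ³`**: `¬ ∀ p ∈ X, U_X(p) ≤ 2E* − θ` (`θ > 0`).  Følner/growth proof, structure-free: truncated cluster
      site sums (`sum_le_tsum_add_of_far`) against the finite floor `2·#F·E* ≤ Σ_F Σ_{F∖p} V_LJ`
      (`two_mul_card_mul_eStar_le`) give `#F_{R−L} ≤ ρ·#F_R`, `ρ < 1` — geometric growth of ball counts vs the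
      cubic packing bound.  Hence `transitiveLocalLimit_level_not_lowerable` (the crux's `= 2E*` cannot become
      `≤ 2E* − θ`, WHATEVER the ground states are) and `exists_site_gt_of_uniformly_bound` (zero slack in M* for
      every `X`, not only periodic ones — cf. `UniformBindingRigidity.Negative.PeriodicCeiling`).
    * `Theorems/TransitiveLocalLimit/Negative/FiniteExcluded.lean` (p151405, ACCEPTED): SMALL MODELS, all `n` at once —
      strict floor `N·E* < E_LJ(y)` (`card_mul_eStar_lt`, far-copy attraction), so NO finite non-empty `X` is uniformly
      `2E*`-bound (`finite_not_uniformly_bound`) or transitive (`finite_not_transitive`); the crux's `X` is INFINITE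
      (`infinite_of_transitive`).  (The sibling M*-file had only `n = 1`.)
    * here: `not_transitiveLocalLimitBelowLevel`, `not_transitiveLocalLimitAtLevel_of_lt` — the crux re-levelled
      at any `L < 2E*` is FALSE outright (ground states exist).  Re-levelling at `L > 2E*` is NOT refuted (it
      would need a certified under-bound local limit, i.e. the surface statement (NHB-thick) of the M* cohesion
      files, open).
(c) NATURAL STRENGTHENINGS: level lowered — dead by (b).  "EVERY local limit (all σ, τ) is transitive" — open,
    equivalent to a sitewise surface-tension statement (a half-crystal limit tracked at an extreme particle has
    its surface site at `≈ −0.99` vs `2E* ≈ −1.435` numerically, `CohesionG` header; no certified bound: with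
    separation `1/3` alone a half-space site can be bound below `2E*`).  "X periodic" — the summit itself.
(d) TARGETS — line `registered` (`Lines/birth.lean`, lead prover-line-…-15100-c2-0; no stuck stubs posted):
    the ONLY open stub is `stub_superBoundSparse` (density of `θ`-super-bound sites `→ 0` along ground states).
    * `stub_superBoundSparse_false_without_minimality` (`Theorems/TransitiveLocalLimit/Negative/StubSuperBoundSparse.lean`,
      p150683, ACCEPTED; witness defs `spikeDir`/`slotPos`/`hedgePos`/`hedge` importable): with `IsGroundState` weakened to
      injectivity the stub is FALSE — hedgehog clusters (centre + 36 unit spikes at rational circle points,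
      clusters `4` apart along `e₂`) have a density `1/37` of `(1/2)`-super-bound sites (`𝓔_centre ≤ −3 ≤ 2E* − 1/2`,
      using `−14.316/6 ≤ 2E*`, `neg_le_two_mul_iInf`, from `Yuhjtman2015_stabilityConstant_holds` + `crysEnergyLimit`).
    * JOINT SUFFICIENCY holds by kernel: `TransitiveLocalLimit_of_parts` (tree) — no gap to find; conversely
      `not_stubSuperBoundSparse_of_not_transitiveLocalLimit` : a kill of the crux kills the stub, and
      (anonymous `example`) a kill of the crux kills K* (rank-2 crux 15098), since `K* ⇒ crux` is PROVED
      (`transitiveLocalLimit_of_noFractionalGain`).  0 targets broken.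
(e) WHY THE CRUX RESISTS (no near-miss kept as `sorry`):
    * LOGICAL POSITION: crux ⇐ stub 1 ⇐ K* (both arrows proved in tree).  Any refutation is therefore at least a
      refutation of `NoFractionalGain`, whose cheapest falsifier (k = 0 Bloch symbol / Perron root of [−V_ij] on
      periodic candidates) came out FOR it: λ_max/λ_hcp = 1 (hcp), 0.999899 (fcc), 0.999949 (dhcp), 0.999965 (9R),
      0.999932 (6H), ≤ 0.969 at Frank–Kasper sites (route file NUMBERS; kit j002036, j017384).
    * DIRECT KILL = exhibit a ground-state sequence NONE of whose local limits is energy-transitive at `2E*`.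
      Nothing certified is known about LJ ground-state geometry beyond separation (`1/3`, tree; `0.684`, Yuhjtman)
      and `E(N)/N → E*`; the generic constraints on a local limit `X` (separated, locally minimal, mean binding
      `2E*` in density) do not preclude transitivity, and (b) shows the level `2E*` is exactly the extremal one.
    * PHYSICAL FAILURE MODES (planner's list) checked against print: (i) a NON-vertex-transitive periodic
      minimiser (two site classes straddling `2E*`) would falsify crux AND stub 1.  It is REAL for nearby
      potentials — truncated/shifted LJ under pressure has `⟨hc⟩` (dhcp), `⟨hhc⟩` (9R-type), `⟨hhcc⟩` ground states
      on the fcc/hcp boundary (Pártay–Ortner–Bartók–Pickard–Csányi 2017, arXiv:1705.01751, §3 p. 5: "at the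
      boundary between the ground state regions of fcc and hcp structures, several other stacking variants are
      found to be more stable"; "hcp … the most favourable stacking variant at lower pressure values") — but for
      the FULL-range potential at ZERO pressure every number points to hcp: e_hcp = −0.717562 < 9R (+2.1e-5) <
      dhcp (+4.9e-5) < 6H (+7.3e-5) < fcc (+1.14e-4) (kit j017384), registry couplings J₂ = −7.3e-5 with
      Σ_{k≥3}|J_k| ≈ 8.5e-8 (ANNNI-type selection of the all-`h` word = hcp, the route's BarlowTransitivityLemma).
      hcp is vertex-transitive (`hcpStacking_homogeneous`), so its bulk limit IS energy-transitive at `2e_hcp`.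
      A certified refutation along (i) would need interval lattice sums putting a two-class polytype BELOW hcp by
      more than the certification error — the sign is wrong by ≥ 2e-5.  Dead for V_LJ; alive only as the remark
      that the crux is potential-specific.  (ii) `E*` not attained (infinite descending chain of periodic
      structures): no model, contradicts the same numerics.  (iii) a positive density of under- or super-bound defect
      sites in EVERY ground state: would contradict the expected `O(N^{2/3})` surface excess; no model either,
      and it is exactly what stub 1 / K* deny.
    * WHAT A PROVER SHOULD TAKE FROM THIS FILE: minimality must enter (a); the level is forced (b) — in particular
      any `X` produced with `U_X ≤ 2E*` everywhere automatically has `sup U_X = 2E*`; the open content is stub 1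
      (finite-`N`, density form), reachable from K* (done) or from positional hinges (`BulkDefectVanish`, lead c2).
-/

noncomputable section

namespace Summit.AtomisticToContinuum.Crystallization.Cruxes.TransitiveLocalLimit.Disproof

open Filter
open Literature.MathematicalPhysics.StatisticalMechanics
open Summit.AtomisticToContinuum.Crystallization.Theses.PerronTransitivity (TransitiveLocalLimit NoFractionalGain)
open Summit.AtomisticToContinuum.Crystallization.Theorems.TransitiveLocalLimit.Negative
open Summit.AtomisticToContinuum.Crystallization.Theorems.TransitiveLocalLimitBirth
  (TransitiveLocalLimit_of_parts transitiveLocalLimit_of_noFractionalGain stub_concentration_of_superBoundSparse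
    stub_centredLocalLimit stub_siteEnergyContinuity)

/-! ## (a) Load-bearing hypotheses -/

/-- The crux with the energy-minimality half of `IsGroundState` dropped (injectivity kept). -/
def TransitiveLocalLimitWithoutMinimality : Prop :=
  ∀ x : (N : ℕ) → (Fin N → EuclideanSpace ℝ (Fin 3)), (∀ N, Function.Injective (x N)) →
    ∃ (X : Set (EuclideanSpace ℝ (Fin 3))) (σ : ℕ → ℕ) (τ : ℕ → EuclideanSpace ℝ (Fin 3)), X.Nonempty ∧
      (∃ δ : ℝ, 0 < δ ∧ ∀ p ∈ X, ∀ q ∈ X, p ≠ q → δ ≤ dist p q) ∧ StrictMono σ ∧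
      (∀ R ε : ℝ, 0 < ε → ∀ᶠ j : ℕ in Filter.atTop,
        (∀ p ∈ X, ‖p‖ ≤ R → ∃ i : Fin (σ j), dist (x (σ j) i + τ j) p ≤ ε) ∧
        (∀ i : Fin (σ j), ‖x (σ j) i + τ j‖ ≤ R → ∃ p ∈ X, dist (x (σ j) i + τ j) p ≤ ε)) ∧
      ∀ p ∈ X, ∑' q : {q : EuclideanSpace ℝ (Fin 3) // q ∈ X ∧ q ≠ p}, lennardJones (dist p q.1) =
        2 * ⨅ Q : PeriodicConfiguration 3, Q.energyPerParticle lennardJones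

/-- Sanity: dropping minimality weakens the hypothesis, so the variant implies the crux. -/
example : TransitiveLocalLimitWithoutMinimality → TransitiveLocalLimit :=
  fun h x hx => h x fun N => (hx N).1

/-- **(a1) Minimality is load-bearing**: the crux without minimality is FALSE (spread-out collinear witness;
landed `LoadBearing.transitiveLocalLimit_false_without_minimality`). [folklore] -/
theorem transitiveLocalLimit_false_without_minimality : ¬ TransitiveLocalLimitWithoutMinimality :=
  LoadBearing.transitiveLocalLimit_false_without_minimality

/-- **(a2) The singleton limit is excluded** (site sum `0 ≠ 2E*`). [folklore] -/
theorem singleton_not_transitive {X : Set (EuclideanSpace ℝ (Fin 3))} {p : EuclideanSpace ℝ (Fin 3)}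
    (hp : p ∈ X) (hX : ∀ q ∈ X, q = p) :
    ∑' q : {q : EuclideanSpace ℝ (Fin 3) // q ∈ X ∧ q ≠ p}, lennardJones (dist p q.1) ≠
      2 * ⨅ Q : PeriodicConfiguration 3, Q.energyPerParticle lennardJones :=
  LoadBearing.singleton_not_transitive hp hX

/-! ## (b) Tightness: `2E*` is the uniform binding floor -/

/-- **(b1) No configuration is uniformly super-bound** (landed `UniformFloor.not_uniformly_superBound`). [folklore] -/
theorem not_uniformly_superBound {X : Set (EuclideanSpace ℝ (Fin 3))} (hne : X.Nonempty) {δ : ℝ} (hδ : 0 < δ)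
    (hsep : ∀ p ∈ X, ∀ q ∈ X, p ≠ q → δ ≤ dist p q) {θ : ℝ} (hθ : 0 < θ)
    (hU : ∀ p ∈ X, ∑' q : {q : EuclideanSpace ℝ (Fin 3) // q ∈ X ∧ q ≠ p}, lennardJones (dist p q.1) ≤
      2 * (⨅ Q : PeriodicConfiguration 3, Q.energyPerParticle lennardJones) - θ) : False :=
  UniformFloor.not_uniformly_superBound hne hδ hsep hθ hU

/-- The crux re-levelled: conclusion `U_X(p) = L` at every site instead of `= 2E*`. -/
def TransitiveLocalLimitAtLevel (L : ℝ) : Prop :=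
  ∀ x : (N : ℕ) → (Fin N → EuclideanSpace ℝ (Fin 3)), (∀ N, IsGroundState lennardJones (x N)) →
    ∃ (X : Set (EuclideanSpace ℝ (Fin 3))) (σ : ℕ → ℕ) (τ : ℕ → EuclideanSpace ℝ (Fin 3)), X.Nonempty ∧
      (∃ δ : ℝ, 0 < δ ∧ ∀ p ∈ X, ∀ q ∈ X, p ≠ q → δ ≤ dist p q) ∧ StrictMono σ ∧
      (∀ R ε : ℝ, 0 < ε → ∀ᶠ j : ℕ in Filter.atTop,
        (∀ p ∈ X, ‖p‖ ≤ R → ∃ i : Fin (σ j), dist (x (σ j) i + τ j) p ≤ ε) ∧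
        (∀ i : Fin (σ j), ‖x (σ j) i + τ j‖ ≤ R → ∃ p ∈ X, dist (x (σ j) i + τ j) p ≤ ε)) ∧
      ∀ p ∈ X, ∑' q : {q : EuclideanSpace ℝ (Fin 3) // q ∈ X ∧ q ≠ p}, lennardJones (dist p q.1) = L

/-- The crux with the exact level weakened to a uniform strict super-binding `U_X(p) ≤ 2E* − θ`. -/
def TransitiveLocalLimitBelowLevel (θ : ℝ) : Prop :=
  ∀ x : (N : ℕ) → (Fin N → EuclideanSpace ℝ (Fin 3)), (∀ N, IsGroundState lennardJones (x N)) →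
    ∃ (X : Set (EuclideanSpace ℝ (Fin 3))) (σ : ℕ → ℕ) (τ : ℕ → EuclideanSpace ℝ (Fin 3)), X.Nonempty ∧
      (∃ δ : ℝ, 0 < δ ∧ ∀ p ∈ X, ∀ q ∈ X, p ≠ q → δ ≤ dist p q) ∧ StrictMono σ ∧
      (∀ R ε : ℝ, 0 < ε → ∀ᶠ j : ℕ in Filter.atTop,
        (∀ p ∈ X, ‖p‖ ≤ R → ∃ i : Fin (σ j), dist (x (σ j) i + τ j) p ≤ ε) ∧
        (∀ i : Fin (σ j), ‖x (σ j) i + τ j‖ ≤ R → ∃ p ∈ X, dist (x (σ j) i + τ j) p ≤ ε)) ∧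
      ∀ p ∈ X, ∑' q : {q : EuclideanSpace ℝ (Fin 3) // q ∈ X ∧ q ≠ p}, lennardJones (dist p q.1) ≤
        2 * (⨅ Q : PeriodicConfiguration 3, Q.energyPerParticle lennardJones) - θ

/-- Sanity: the crux is the case `L = 2E*` of the re-levelled family. -/
example : TransitiveLocalLimitAtLevel (2 * ⨅ Q : PeriodicConfiguration 3, Q.energyPerParticle lennardJones) ↔
    TransitiveLocalLimit := Iff.rfl

/-- **(b2) The level cannot be lowered uniformly**: `TransitiveLocalLimitBelowLevel θ` is FALSE for every
`θ > 0` (ground states exist; their would-be limit contradicts the uniform floor). [folklore] -/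
theorem not_transitiveLocalLimitBelowLevel {θ : ℝ} (hθ : 0 < θ) : ¬ TransitiveLocalLimitBelowLevel θ := by
  intro h
  choose x hx using LennardJonesGroundStatesExist_holds
  obtain ⟨X, σ, τ, hne, hsep, -, -, hU⟩ := h x hx
  exact UniformFloor.transitiveLocalLimit_level_not_lowerable hθ ⟨X, hne, hsep, hU⟩

/-- **(b3) No lower level works**: `TransitiveLocalLimitAtLevel L` is FALSE for every `L < 2E*`.
(`L > 2E*` is NOT refuted here — see the module docstring, (b).) [folklore] -/
theorem not_transitiveLocalLimitAtLevel_of_lt {L : ℝ}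
    (hL : L < 2 * ⨅ Q : PeriodicConfiguration 3, Q.energyPerParticle lennardJones) :
    ¬ TransitiveLocalLimitAtLevel L := by
  intro h
  refine not_transitiveLocalLimitBelowLevel (θ := 2 * (⨅ Q : PeriodicConfiguration 3,
    Q.energyPerParticle lennardJones) - L) (by linarith) fun x hx => ?_
  obtain ⟨X, σ, τ, hne, hsep, hσ, hmatch, hU⟩ := h x hx
  exact ⟨X, σ, τ, hne, hsep, hσ, hmatch, fun p hp => by rw [hU p hp]; linarith⟩

/-- **(b4) Zero slack for M*-type hypotheses, every `X`**: a non-empty uniformly discrete `X` has, for every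
`θ > 0`, a site bound no better than `2E* − θ`. [folklore] -/
theorem exists_site_gt {X : Set (EuclideanSpace ℝ (Fin 3))} (hne : X.Nonempty) {δ : ℝ}
    (hδ : 0 < δ) (hsep : ∀ p ∈ X, ∀ q ∈ X, p ≠ q → δ ≤ dist p q) {θ : ℝ} (hθ : 0 < θ) :
    ∃ p ∈ X, 2 * (⨅ Q : PeriodicConfiguration 3, Q.energyPerParticle lennardJones) - θ <
      ∑' q : {q : EuclideanSpace ℝ (Fin 3) // q ∈ X ∧ q ≠ p}, lennardJones (dist p q.1) :=
  UniformFloor.exists_site_gt_of_uniformly_bound hne hδ hsep hθ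

/-- **(b5) Small models excluded, all `n`**: the `X` of the crux conclusion is infinite (landed
`FiniteExcluded.infinite_of_transitive`; no finite non-empty `X` is even uniformly `2E*`-bound,
`FiniteExcluded.finite_not_uniformly_bound`). [folklore] -/
theorem infinite_of_transitive {X : Set (EuclideanSpace ℝ (Fin 3))} (hne : X.Nonempty)
    (hU : ∀ p ∈ X, ∑' q : {q : EuclideanSpace ℝ (Fin 3) // q ∈ X ∧ q ≠ p}, lennardJones (dist p q.1) =
        2 * ⨅ Q : PeriodicConfiguration 3, Q.energyPerParticle lennardJones) : X.Infinite :=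
  FiniteExcluded.infinite_of_transitive hne hU

/-! ## (d) Targets — line `registered` (`Lines/birth.lean`): the open stub `stub_superBoundSparse` -/

/-- STUB 1 of the registered line, verbatim: no density of `θ`-super-bound sites along ground states. -/
def StubSuperBoundSparse : Prop :=
  ∀ x : (N : ℕ) → (Fin N → EuclideanSpace ℝ (Fin 3)), (∀ N, IsGroundState lennardJones (x N)) →
    ∀ θ : ℝ, 0 < θ → Filter.Tendsto (fun N : ℕ => ((Finset.univ.filter fun i : Fin N =>
      siteEnergy lennardJones (x N) i ≤
        2 * (⨅ Q : PeriodicConfiguration 3, Q.energyPerParticle lennardJones) - θ).card : ℝ) / N)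
      Filter.atTop (nhds 0)

/-- STUB 1 with `IsGroundState` weakened to injectivity. -/
def StubSuperBoundSparseWithoutMinimality : Prop :=
  ∀ x : (N : ℕ) → (Fin N → EuclideanSpace ℝ (Fin 3)), (∀ N, Function.Injective (x N)) →
    ∀ θ : ℝ, 0 < θ → Filter.Tendsto (fun N : ℕ => ((Finset.univ.filter fun i : Fin N =>
      siteEnergy lennardJones (x N) i ≤
        2 * (⨅ Q : PeriodicConfiguration 3, Q.energyPerParticle lennardJones) - θ).card : ℝ) / N)
      Filter.atTop (nhds 0)

/-- Sanity: the weakened stub implies the stub. -/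
example : StubSuperBoundSparseWithoutMinimality → StubSuperBoundSparse :=
  fun h x hx => h x fun N => (hx N).1

/-- **Joint sufficiency is kernel-checked; conversely a kill of the crux kills the stub** (stubs 2–4 landed). [folklore] -/
theorem not_stubSuperBoundSparse_of_not_transitiveLocalLimit :
    ¬ TransitiveLocalLimit → ¬ StubSuperBoundSparse := fun h hs =>
  h (TransitiveLocalLimit_of_parts hs stub_concentration_of_superBoundSparse stub_centredLocalLimit
    stub_siteEnergyContinuity)

/-- **A kill of the crux kills K*** (`NoFractionalGain`, crux 15098): `K* ⇒ crux` is proved in tree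
(`transitiveLocalLimit_of_noFractionalGain`).  Kept anonymous so that no conditional-refutation edge is indexed. -/
example : ¬ TransitiveLocalLimit → ¬ NoFractionalGain :=
  mt transitiveLocalLimit_of_noFractionalGain


/-- **(d1) Minimality is load-bearing for STUB 1**: the stub without minimality is FALSE (hedgehog witness:
density `1/37` of `(1/2)`-super-bound centres; landed `Negative/StubSuperBoundSparse.lean`, whose `hedge`,
`siteEnergy_centre_le`, `le_card_superBound` are importable). [folklore] -/
theorem stub_superBoundSparse_false_without_minimality : ¬ StubSuperBoundSparseWithoutMinimality :=
  Summit.AtomisticToContinuum.Crystallization.Theorems.TransitiveLocalLimit.Negative.StubSuperBoundSparse.stub_superBoundSparse_false_without_minimality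

/-- **(d2) The super-bound threshold is explicit**: `−14.316/6 ≤ 2E*` (Yuhjtman 2015, Thm. 9 + `crysEnergyLimit`),
so `θ`-super-bound means `𝓔ⁱ ≤ 2E* − θ ≤ −1.422 − θ` and `≥ −2.386 − θ` is all a witness needs.
[cite: Yuhjtman2015, Thm. 9] -/
theorem neg_le_two_mul_iInf :
    -(14.316 / 6 : ℝ) ≤ 2 * ⨅ Q : PeriodicConfiguration 3, Q.energyPerParticle lennardJones :=
  Summit.AtomisticToContinuum.Crystallization.Theorems.TransitiveLocalLimit.Negative.StubSuperBoundSparse.neg_le_two_mul_iInf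

end Summit.AtomisticToContinuum.Crystallization.Cruxes.TransitiveLocalLimit.Disproof

end
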